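import Literature.AlgebraicGeometry.Resolution.ImmediateRationalUniformization
import Literature.AlgebraicGeometry.Resolution.KnafKuhlmann2009Prop310
import Mathlib.RingTheory.AlgebraicIndependent.Adjoin
import Mathlib.RingTheory.AlgebraicIndependent.Transcendental
import Mathlib.RingTheory.AlgebraicIndependent.AlgebraicClosure
import HarnessLib

/-!
# The purely transcendental tower of the dense-Abhyankar range (Knaf–Kuhlmann 2009, Prop. 3.11)

Stub D3 of the line `pfaff-line-log-final-forms` for the crux `Valuative.LuAlphaPTorsor`
(reshape v6.5): in the ambient vocabulary of `Literature/AlgebraicGeometry/Resolution/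
ValuedFunctionFields.lean` (one valued field `(Ω, V)`, subfields `K₀ ≤ F₀ ≤ F ≤ Ω`,
`O_E = V ∩ E`), strong smooth `O_{K₀}`-uniformizability climbs from `F₀` to `F₀(y₁, …, y_s)`
whenever `y` is algebraically independent over `F₀` inside a field `F` which is dense over `F₀`
("`F` lies in the completion of `F₀`").

This is the induction in the proof of Knaf–Kuhlmann 2009, Prop. 3.11 (purely transcendental
part): each step `L = F₀(y₁,…,y_j) ≤ L(y_{j+1})` is
* density ⇒ the hypotheses of Lemma 3.9 (immediateness of `L(z)|L` and Kaplansky's condition (3);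
  taken here as the hypothesis `stub_denseKaplansky` of the neighbouring stub D1),
* Lemma 3.9 (`isSmoothlyUniformizableIn_of_immediate_of_kaplansky`, PROVED in the tree): `L(z)` is
  strongly smoothly `O_L`-uniformizable,
* Cor. 3.6 (`knafKuhlmann2009_cor36`, PROVED in the tree): transitivity down to `O_{K₀}`.

## Source

* H. Knaf, F.-V. Kuhlmann, *Every place admits local uniformization in a finite extension of
  the function field*, Adv. Math. 221 (2009) 428–453 = arXiv:math/0702856, Prop. 3.11 (proof),
  Lemma 3.9, Cor. 3.6.
-/

set_option linter.dupNamespace false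

namespace Summit.ResolutionOfSingularities.ResolutionOfSingularities.Theorems.PfaffLine

open Literature.AlgebraicGeometry.Resolution

/-- Transcendence over an intermediate field in polynomial form: if `z` is transcendental over
`M`, no non-zero polynomial over `Ω` with coefficients in `M` vanishes at `z`. [folklore] -/
theorem forall_eval_eq_zero_of_transcendental_intermediateField {F Ω : Type*} [Field F] [Field Ω]
    [Algebra F Ω] (M : IntermediateField F Ω) {z : Ω} (hz : Transcendental M z) :
    ∀ P : Polynomial Ω, (∀ k, P.coeff k ∈ M.toSubfield) → P.eval z = 0 → P = 0 := by
  intro P hP hPz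
  obtain ⟨Q, hQ⟩ : ∃ Q : Polynomial M, Q.map (algebraMap M Ω) = P :=
    (Polynomial.mem_lifts P).mp ((Polynomial.lifts_iff_coeff_lifts P).mpr
      fun k => ⟨⟨P.coeff k, hP k⟩, rfl⟩)
  by_contra hP0
  refine hz ⟨Q, fun h => hP0 ?_, ?_⟩
  · rw [← hQ, h, Polynomial.map_zero]
  · rw [Polynomial.aeval_def, ← Polynomial.eval_map, hQ, hPz]

/-- The subfield underlying `F₀(S)` for a subfield `F₀ ⊆ Ω` is `Subfield.closure (F₀ ∪ S)`.
[folklore] -/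
theorem toSubfield_adjoin_subfield {Ω : Type*} [Field Ω] (F₀ : Subfield Ω) (S : Set Ω) :
    (IntermediateField.adjoin F₀ S).toSubfield = Subfield.closure ((F₀ : Set Ω) ∪ S) := by
  rw [IntermediateField.adjoin_toSubfield, range_algebraMap_subfield]

/-- **Knaf–Kuhlmann 2009, Prop. 3.11 (purely transcendental part of the proof).** Given the
density-to-Kaplansky statement D1 (first hypothesis), strong smooth `O_{K₀}`-uniformizability
climbs from `F₀` to `F₀(y₁,…,y_s)` for `y` algebraically independent over `F₀` inside a field `F`
dense over `F₀`: induction on `s`, each step being D1 + Lemma 3.9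
(`isSmoothlyUniformizableIn_of_immediate_of_kaplansky`) over `O_L`, `L = F₀(y₁,…,y_j)`, followed
by Cor. 3.6 (`knafKuhlmann2009_cor36`). [cite: KnafKuhlmann2009, Prop. 3.11 (proof)] -/
theorem stub_denseTranscendentalTower :
    (∀ (Ω : Type) [Field Ω] (V : ValuationSubring Ω) (L F : Subfield Ω) (z : Ω), L ≤ F → z ∈ F → (∀ x ∈ F, ∀ w ∈ F, w ≠ 0 → ∃ a ∈ L, V.valuation (x - a) < V.valuation w) → (∀ P : Polynomial Ω, (∀ k, P.coeff k ∈ L) → P.eval z = 0 → P = 0) → (∀ w ∈ Subfield.closure ((L : Set Ω) ∪ {z}), w ≠ 0 → ∃ b ∈ L, V.valuation w = V.valuation b) ∧ (∀ w ∈ Subfield.closure ((L : Set Ω) ∪ {z}), w ∈ V → ∃ c ∈ L, V.valuation (w - c) < 1) ∧ (∀ g : Polynomial Ω, (∀ k, g.coeff k ∈ L) → ∃ a₀ ∈ L, ∃ α : V.ValueGroup, ∀ a ∈ L, V.valuation (z - a) ≤ V.valuation (z - a₀) → V.valuation (g.eval a) = α)) →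
    ∀ (Ω : Type) [Field Ω] (V : ValuationSubring Ω) (K₀ F₀ F : Subfield Ω) (s : ℕ) (y : Fin s → Ω), K₀ ≤ F₀ → F₀ ≤ F → (∀ i, y i ∈ F) → AlgebraicIndependent F₀ y → (∀ x ∈ F, ∀ w ∈ F, w ≠ 0 → ∃ a ∈ F₀, V.valuation (x - a) < V.valuation w) → (∀ Z : Finset Ω, (∀ z ∈ Z, z ∈ V ∧ z ∈ F₀) → Literature.AlgebraicGeometry.Resolution.IsSmoothlyUniformizableIn ↥(V.toSubring ⊓ K₀.toSubring) V F₀ (Z : Set Ω)) → ∀ Z : Finset Ω, (∀ z ∈ Z, z ∈ V ∧ z ∈ (IntermediateField.adjoin F₀ (Set.range y)).toSubfield) → Literature.AlgebraicGeometry.Resolution.IsSmoothlyUniformizableIn ↥(V.toSubring ⊓ K₀.toSubring) V (IntermediateField.adjoin F₀ (Set.range y)).toSubfield (Z : Set Ω) := by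
  intro hD1 Ω _ V K₀ F₀ F s
  induction s with
  | zero =>
    intro y _hK₀F₀ _hF₀F _hyF _hy _hdense hF₀ Z hZ
    have hbot : (IntermediateField.adjoin F₀ (Set.range y)).toSubfield = F₀ := by
      rw [toSubfield_adjoin_subfield, Set.range_eq_empty, Set.union_empty, Subfield.closure_eq]
    rw [hbot] at hZ ⊢
    exact hF₀ Z hZ
  | succ s ih =>
    intro y hK₀F₀ hF₀F hyF hy hdense hF₀ Z hZ
    -- the first `s` coordinates and the last one
    set y' : Fin s → Ω := y ∘ Fin.castSucc with hy'def
    set z : Ω := y (Fin.last s) with hzdef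
    set L : Subfield Ω := (IntermediateField.adjoin F₀ (Set.range y')).toSubfield with hLdef
    -- induction hypothesis: `L` is strongly smoothly `O_{K₀}`-uniformizable
    have hL : ∀ Z : Finset Ω, (∀ w ∈ Z, w ∈ V ∧ w ∈ L) →
        IsSmoothlyUniformizableIn ↥(V.toSubring ⊓ K₀.toSubring) V L (Z : Set Ω) :=
      ih y' hK₀F₀ hF₀F (fun i => hyF _) (hy.comp _ (Fin.castSucc_injective s)) hdense hF₀
    have hF₀L : F₀ ≤ L := fun x hx =>
      (IntermediateField.adjoin F₀ (Set.range y')).algebraMap_mem ⟨x, hx⟩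
    have hK₀L : K₀ ≤ L := hK₀F₀.trans hF₀L
    have hLF : L ≤ F := by
      rw [hLdef, toSubfield_adjoin_subfield, Subfield.closure_le]
      rintro x (hx | ⟨i, rfl⟩)
      · exact hF₀F hx
      · exact hyF _
    have hzF : z ∈ F := hyF _
    -- `z` is transcendental over `L = F₀(y')`
    have hlast : Fin.last s ∉ Set.range (Fin.castSucc : Fin s → Fin (s + 1)) := by
      rintro ⟨j, hj⟩
      exact Fin.castSucc_ne_last j hj
    have htr : Transcendental (Algebra.adjoin F₀ (Set.range y')) z := by
      have h := hy.transcendental_adjoin hlast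
      rwa [← Set.range_comp] at h
    have htrL : Transcendental (IntermediateField.adjoin F₀ (Set.range y')) z :=
      IntermediateField.transcendental_adjoin_iff.mpr htr
    have htrans : ∀ P : Polynomial Ω, (∀ k, P.coeff k ∈ L) → P.eval z = 0 → P = 0 :=
      forall_eval_eq_zero_of_transcendental_intermediateField _ htrL
    -- density of `F` over `L`
    have hdenseL : ∀ x ∈ F, ∀ w ∈ F, w ≠ 0 → ∃ a ∈ L, V.valuation (x - a) < V.valuation w := by
      intro x hx w hw hw0
      obtain ⟨a, haF₀, h⟩ := hdense x hx w hw hw0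
      exact ⟨a, hF₀L haF₀, h⟩
    -- D1: the hypotheses of Lemma 3.9
    obtain ⟨hval, hres, h3⟩ := hD1 Ω V L F z hLF hzF hdenseL htrans
    -- Lemma 3.9: `L(z)` is strongly smoothly `O_L`-uniformizable
    have hE : ∀ Z : Finset Ω, (∀ w ∈ Z, w ∈ V ∧ w ∈ Subfield.closure ((L : Set Ω) ∪ {z})) →
        IsSmoothlyUniformizableIn ↥(V.toSubring ⊓ L.toSubring) V
          (Subfield.closure ((L : Set Ω) ∪ {z})) (Z : Set Ω) :=
      isSmoothlyUniformizableIn_of_immediate_of_kaplansky V L htrans hval hres h3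
    have hLE : L ≤ Subfield.closure ((L : Set Ω) ∪ {z}) := fun x hx =>
      Subfield.subset_closure (Or.inl hx)
    -- `L(z) = F₀(y)`
    have hEq : Subfield.closure ((L : Set Ω) ∪ {z}) =
        (IntermediateField.adjoin F₀ (Set.range y)).toSubfield := by
      apply le_antisymm
      · rw [Subfield.closure_le]
        rintro x (hx | hx)
        · exact IntermediateField.adjoin.mono F₀ _ _ (Set.range_comp_subset_range _ _) hx
        · rw [Set.mem_singleton_iff] at hx
          rw [hx]
          exact IntermediateField.subset_adjoin F₀ _ ⟨Fin.last s, rfl⟩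
      · rw [toSubfield_adjoin_subfield, Subfield.closure_le]
        rintro x (hx | ⟨i, rfl⟩)
        · exact hLE (hF₀L hx)
        · rcases Fin.eq_castSucc_or_eq_last i with ⟨j, rfl⟩ | rfl
          · exact hLE (IntermediateField.subset_adjoin F₀ (Set.range y') ⟨j, rfl⟩)
          · exact Subfield.subset_closure (Or.inr rfl)
    rw [← hEq] at hZ ⊢
    -- Cor. 3.6
    exact knafKuhlmann2009_cor36 V hK₀L hLE hL hE Z hZ

end Summit.ResolutionOfSingularities.ResolutionOfSingularities.Theorems.PfaffLine
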